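/-
Origin: expansion seat `planner-pub-hodgecm-pv09-g4-0`, handover #3 2026-08-18T07:14:39Z (`HOME/pub-hodgecm-pv09-g4/lean/Pv09g4/CocompactFundamentalDomain.lean`, md5 b286e7f7, 176 lines);
landed by the gen-7 packager in gate run 25 as `HodgeCM/PerL34/CocompactFundamentalDomain.lean` (import ^import Pv[0-9]+g[0-9]+\.→import HodgeCM.PerL34. ×1).
-/
/-
HodgeCM / PerL34 publication cell — seam S3 support (pub-hodgecm-pv09-g4, HANDOVER #3).
Imports `Pv09g4.DiscreteFundamentalDomain` (HANDOVER #2 (a) ↦ `HodgeCM.PerL34.DiscreteFundamentalDomain`).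
Complete proofs, no new axioms, no cited facts.
-/
import Summits.HodgeConjecture.HodgeCM.PerL34.DiscreteFundamentalDomain_2

/-!
# Fundamental domains for cocompact discrete subgroups WITHOUT second countability

`DiscreteFundamentalDomain.lean` assumes `SecondCountableTopology G` (to extract a countable subcover).
For the COCOMPACT case this is unnecessary: the compact set `K` meeting every orbit has a finite subcover,
and in general a LINDELÖF `K` suffices.  This file proves the Lindelöf form of the abstract theorem and
the cocompact existence theorems under exactly the hypotheses carried by the model structures of the
core side (`HodgeCM.Automorphic.QuotientModel`: `[DiscreteTopology Γ] [Countable Γ]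
[LocallyCompactSpace G] [CompactSpace (G ⧸ Γ)]`, Borel σ-algebra) and by pv11-g4's idelic torus
`relNormOneRat K L ≤ relNormOneIdeles K L` (`discreteTopology_relNormOneRat`,
`compactSpace_relNormOneQuot`, `locallyCompactSpace_relNormOneIdeles`):

* `exists_subset_measurableSet_existsUnique_of_isLindelof` — abstract theorem, `IsLindelof K`;
* `exists_fundamentalDomain_op_relCompact'` / `_left_relCompact'`,
  `exists_isFundamentalDomain_op_finite'` / `_left_finite'` — `[Countable Γ] [DiscreteTopology Γ]
  [LocallyCompactSpace G] [CompactSpace (G ⧸ Γ)]`, no second countability;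
* `exists_fundamentalDomain_left/op_of_lindelof` — plain existence for a Lindelöf (e.g. σ-compact) `G`
  (Margulis, *Discrete subgroups of semisimple Lie groups*, I.0.40; Bourbaki INT VII §2 ex. 12).
-/

set_option autoImplicit false

noncomputable section

open MeasureTheory Set Filter Topology
open scoped Pointwise

namespace HodgeCM.PerL34.DiscreteFD

/-! ## §1 The abstract theorem for a Lindelöf `K` -/

section Local

variable {Γ : Type*} {X : Type*} [Group Γ] [MulAction Γ X] [TopologicalSpace X]

/-- A countable family of open sets, each moved off itself by every `γ ≠ 1`, covering a Lindelöf `K`. -/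
theorem exists_seq_of_isLindelof {K : Set X} (hKL : IsLindelof K)
    (hV : ∀ x ∈ K, ∃ V : Set X, IsOpen V ∧ x ∈ V ∧ ∀ γ : Γ, γ ≠ 1 → Disjoint (γ • V) V) :
    ∃ u : ℕ → Set X, (∀ n, IsOpen (u n)) ∧
      (∀ (n : ℕ) (γ : Γ), γ ≠ 1 → Disjoint (γ • u n) (u n)) ∧ K ⊆ ⋃ n, u n := by
  rcases K.eq_empty_or_nonempty with rfl | hK
  · exact ⟨fun _ => ∅, fun _ => isOpen_empty, fun n γ _ => by simp, empty_subset _⟩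
  have hV' : ∀ x : K, ∃ V : Set X, IsOpen V ∧ (x : X) ∈ V ∧
      ∀ γ : Γ, γ ≠ 1 → Disjoint (γ • V) V := fun x => hV x x.2
  choose V hVo hxV hVd using hV'
  obtain ⟨T, hTc, hTU⟩ := hKL.elim_countable_subcover V hVo
    (fun x hx => mem_iUnion.2 ⟨⟨x, hx⟩, hxV _⟩)
  haveI : Nonempty K := hK.to_subtype
  obtain ⟨f, hf⟩ := Set.countable_iff_exists_subset_range.1 hTc
  refine ⟨fun n => V (f n), fun n => hVo _, fun n γ hγ => hVd _ γ hγ, fun x hx => ?_⟩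
  obtain ⟨i, hi, hxi⟩ := mem_iUnion₂.1 (hTU hx)
  obtain ⟨n, rfl⟩ := hf hi
  exact mem_iUnion.2 ⟨n, hxi⟩

/-- **Abstract existence theorem, Lindelöf form.**  A countable group acting measurably, a measurable
LINDELÖF `K` meeting every orbit, local separation at the points of `K` ⇒ a measurable `𝓕 ⊆ K`
meeting every orbit in exactly one point. -/
theorem exists_subset_measurableSet_existsUnique_of_isLindelof
    [MeasurableSpace X] [OpensMeasurableSpace X] [Countable Γ] [MeasurableConstSMul Γ X]
    {K : Set X} (hKm : MeasurableSet K) (hKL : IsLindelof K) (hKcov : ∀ x : X, ∃ γ : Γ, γ • x ∈ K)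
    (hV : ∀ x ∈ K, ∃ V : Set X, IsOpen V ∧ x ∈ V ∧ ∀ γ : Γ, γ ≠ 1 → Disjoint (γ • V) V) :
    ∃ 𝓕 : Set X, 𝓕 ⊆ K ∧ MeasurableSet 𝓕 ∧ ∀ x : X, ∃! γ : Γ, γ • x ∈ 𝓕 := by
  obtain ⟨u, huo, hud, hKu⟩ := exists_seq_of_isLindelof (Γ := Γ) hKL hV
  refine ⟨dom Γ (fun n => u n ∩ K), dom_subset fun n => inter_subset_right,
    measurableSet_dom fun n => (huo n).measurableSet.inter hKm,
    existsUnique_smul_mem_dom (fun n γ hγ => ?_) (fun x => ?_)⟩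
  · exact (hud n γ hγ).mono (smul_set_mono inter_subset_left) inter_subset_left
  · obtain ⟨γ, hγ⟩ := hKcov x
    obtain ⟨n, hn⟩ := mem_iUnion.1 (hKu hγ)
    exact ⟨γ, n, hn, hγ⟩

end Local

/-! ## §2 Discrete subgroups: Lindelöf groups and cocompact subgroups, no second countability -/

section Group

variable {G : Type*} [Group G] [TopologicalSpace G] [IsTopologicalGroup G] [MeasurableSpace G]
  [BorelSpace G]

/-- (Ported verbatim from the HodgeCMPerL package; no docstring in the source.) -/
instance countable_op' (Γ : Subgroup G) [Countable Γ] : Countable Γ.op :=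
  Countable.of_equiv _ Γ.equivOp

/-- Left action, inside a covering measurable Lindelöf `K`. -/
theorem exists_fundamentalDomain_left_subset' (Γ : Subgroup G) [DiscreteTopology Γ] [Countable Γ]
    {K : Set G} (hKm : MeasurableSet K) (hKL : IsLindelof K)
    (hKcov : ∀ x : G, ∃ γ : Γ, γ • x ∈ K) :
    ∃ 𝓕 : Set G, 𝓕 ⊆ K ∧ MeasurableSet 𝓕 ∧ ∀ x : G, ∃! γ : Γ, γ • x ∈ 𝓕 :=
  exists_subset_measurableSet_existsUnique_of_isLindelof hKm hKL hKcov
    fun x _ => exists_local_left Γ x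

/-- Right action (`Γ.op`), inside a covering measurable Lindelöf `K`. -/
theorem exists_fundamentalDomain_op_subset' (Γ : Subgroup G) [DiscreteTopology Γ] [Countable Γ]
    {K : Set G} (hKm : MeasurableSet K) (hKL : IsLindelof K)
    (hKcov : ∀ x : G, ∃ γ : Γ.op, γ • x ∈ K) :
    ∃ 𝓕 : Set G, 𝓕 ⊆ K ∧ MeasurableSet 𝓕 ∧ ∀ x : G, ∃! γ : Γ.op, γ • x ∈ 𝓕 :=
  exists_subset_measurableSet_existsUnique_of_isLindelof hKm hKL hKcov
    fun x _ => exists_local_op Γ x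

/-- **Existence for a Lindelöf group** (σ-compact suffices), left action. -/
theorem exists_fundamentalDomain_left_of_lindelof [LindelofSpace G] (Γ : Subgroup G)
    [DiscreteTopology Γ] [Countable Γ] :
    ∃ 𝓕 : Set G, MeasurableSet 𝓕 ∧ ∀ x : G, ∃! γ : Γ, γ • x ∈ 𝓕 := by
  obtain ⟨𝓕, -, h⟩ := exists_fundamentalDomain_left_subset' Γ MeasurableSet.univ isLindelof_univ
    (fun x => ⟨1, mem_univ _⟩)
  exact ⟨𝓕, h⟩

/-- **Existence for a Lindelöf group** (σ-compact suffices), right action. -/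
theorem exists_fundamentalDomain_op_of_lindelof [LindelofSpace G] (Γ : Subgroup G)
    [DiscreteTopology Γ] [Countable Γ] :
    ∃ 𝓕 : Set G, MeasurableSet 𝓕 ∧ ∀ x : G, ∃! γ : Γ.op, γ • x ∈ 𝓕 := by
  obtain ⟨𝓕, -, h⟩ := exists_fundamentalDomain_op_subset' Γ MeasurableSet.univ isLindelof_univ
    (fun x => ⟨1, mem_univ _⟩)
  exact ⟨𝓕, h⟩

variable [LocallyCompactSpace G]

/-- **Cocompact case, right action, no second countability**: a relatively compact measurable
fundamental domain. -/
theorem exists_fundamentalDomain_op_relCompact' (Γ : Subgroup G) [DiscreteTopology Γ] [Countable Γ]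
    [CompactSpace (G ⧸ Γ)] :
    ∃ 𝓕 : Set G, MeasurableSet 𝓕 ∧ IsCompact (closure 𝓕) ∧
      ∀ x : G, ∃! γ : Γ.op, γ • x ∈ 𝓕 := by
  obtain ⟨K, hKc, hKcl, hK⟩ := exists_isCompact_cover_op Γ
  obtain ⟨𝓕, h𝓕K, h𝓕m, h⟩ :=
    exists_fundamentalDomain_op_subset' Γ hKcl.measurableSet hKc.isLindelof hK
  exact ⟨𝓕, h𝓕m, hKc.of_isClosed_subset isClosed_closure (closure_minimal h𝓕K hKcl), h⟩

/-- **Cocompact case, left action, `Γ` normal, no second countability.** -/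
theorem exists_fundamentalDomain_left_relCompact' (Γ : Subgroup G) [DiscreteTopology Γ]
    [Countable Γ] [Γ.Normal] [CompactSpace (G ⧸ Γ)] :
    ∃ 𝓕 : Set G, MeasurableSet 𝓕 ∧ IsCompact (closure 𝓕) ∧
      ∀ x : G, ∃! γ : Γ, γ • x ∈ 𝓕 := by
  obtain ⟨K, hKc, hKcl, hK⟩ := exists_isCompact_cover_left Γ
  obtain ⟨𝓕, h𝓕K, h𝓕m, h⟩ :=
    exists_fundamentalDomain_left_subset' Γ hKcl.measurableSet hKc.isLindelof hK
  exact ⟨𝓕, h𝓕m, hKc.of_isClosed_subset isClosed_closure (closure_minimal h𝓕K hKcl), h⟩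

/-- Measure form, right action: for every measure finite on compact sets, a measurable fundamental
domain for `Γ.op` of finite measure, relatively compact. -/
theorem exists_isFundamentalDomain_op_finite' (Γ : Subgroup G) [DiscreteTopology Γ] [Countable Γ]
    [CompactSpace (G ⧸ Γ)] (μ : Measure G) [IsFiniteMeasureOnCompacts μ] :
    ∃ 𝓕 : Set G, MeasurableSet 𝓕 ∧ IsFundamentalDomain Γ.op 𝓕 μ ∧
      IsCompact (closure 𝓕) ∧ μ 𝓕 < ⊤ := by
  obtain ⟨𝓕, h𝓕m, hc, h⟩ := exists_fundamentalDomain_op_relCompact' Γ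
  exact ⟨𝓕, h𝓕m, isFundamentalDomain_of_existsUnique h𝓕m h μ, hc,
    (measure_mono subset_closure).trans_lt hc.measure_lt_top⟩

/-- Measure form, left action, `Γ` normal. -/
theorem exists_isFundamentalDomain_left_finite' (Γ : Subgroup G) [DiscreteTopology Γ]
    [Countable Γ] [Γ.Normal] [CompactSpace (G ⧸ Γ)] (μ : Measure G)
    [IsFiniteMeasureOnCompacts μ] :
    ∃ 𝓕 : Set G, MeasurableSet 𝓕 ∧ IsFundamentalDomain Γ 𝓕 μ ∧
      IsCompact (closure 𝓕) ∧ μ 𝓕 < ⊤ := by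
  obtain ⟨𝓕, h𝓕m, hc, h⟩ := exists_fundamentalDomain_left_relCompact' Γ
  exact ⟨𝓕, h𝓕m, isFundamentalDomain_of_existsUnique h𝓕m h μ, hc,
    (measure_mono subset_closure).trans_lt hc.measure_lt_top⟩

/-- `HasFundamentalDomain` for the right action of a cocompact discrete countable subgroup. -/
theorem hasFundamentalDomain_op' (Γ : Subgroup G) [DiscreteTopology Γ] [Countable Γ]
    [CompactSpace (G ⧸ Γ)] (μ : Measure G) : HasFundamentalDomain Γ.op G μ := by
  obtain ⟨𝓕, h𝓕m, -, h⟩ := exists_fundamentalDomain_op_relCompact' Γ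
  exact ⟨⟨𝓕, isFundamentalDomain_of_existsUnique h𝓕m h μ⟩⟩

end Group

end HodgeCM.PerL34.DiscreteFD

end
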